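import Mathlib.RingTheory.AlgebraicIndependent.Defs
import Literature.NumberTheory.Transcendental.PeriodsWave0
import Literature.Barriers.KontsevichZagierPeriods.GrothendieckPeriodConjectureDependenceOddZetaProofs

/-!
# `NormalFormPrinciple` (stmt-KontsevichZagierPeriods-3869), line `SketchIdeator1` —
# the level-one box tower: `Indep_ℚ(1, ζ(2), …, ζ(D))` from the conjecture on `π, ζ(3), ζ(5), …`

Pure proof file (stub `indepZeta_of_piOddZetaAlgebraicIndependent` of the level-one box tower,
lead seat c7; `--supports` the crux). Conjecture 1 of Kontsevich–Zagier on the level-one box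
tower `[(0,1)ʷ, P/(1 − ∏ xᵢ)]` (values `Σ_{j=2}^{D} β_j ζ(j) + q`) is proved by the line
conditionally on the hypothesis

  `Indep_ℚ(1, ζ(2), …, ζ(D))`: every rational linear relation `Σ_{2 ≤ j ≤ D} n_j ζ(j) + r = 0`
  (`n_j, r ∈ ℚ`) is trivial.

This file derives that hypothesis, for every height `D`, from the tree's standing open conjecture
`Literature.NumberTheory.Transcendental.PiOddZetaAlgebraicIndependent` (the numbers
`π, ζ(3), ζ(5), ζ(7), …`, i.e. the family `piOddZetaFamily : ℕ → ℝ`, `0 ↦ π`,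
`m + 1 ↦ ζ(2m+3)`, are algebraically independent over `ℚ`; Waldschmidt 2004, §3.2
Conjecture 3.17). The conjecture enters only as the explicit hypothesis
`(h : PiOddZetaAlgebraicIndependent)`: the theorem is an implication.

Proof. Given a relation `Σ_{j=2}^{D} n_j ζ(j) + r = 0`, write each zeta value as a rational
multiple of a monomial in the family: for even `j = 2k`, Euler's `ζ(2k) = q_k π^{2k}` with
`q_k ∈ ℚ`, `q_k ≠ 0` (the tree's
`Literature.Barriers.KontsevichZagierPeriods.exists_rat_ne_zero_zetaValue_two_mul_eq`, from
Mathlib's `hasSum_zeta_nat`), monomial `X₀ʲ`; for odd `j = 2m+3`, `ζ(j) = piOddZetaFamily (m+1)`,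
monomial `X_{m+1}`. The polynomial `F := C r + Σ_j C (n_j q_j) · (monomial of ζ(j))` in
`MvPolynomial ℕ ℚ` then satisfies `aeval piOddZetaFamily F = Σ n_j ζ(j) + r = 0`, so `F = 0` by
algebraic independence (Mathlib `AlgebraicIndependent.eq_zero_of_aeval_eq_zero`); the exponent
vectors of the `ζ(j)`, `2 ≤ j ≤ D`, are pairwise distinct and non-zero, so reading off the
coefficients of `F = 0` gives `r = 0` and `n_j q_j = 0`, i.e. `n_j = 0`.

Sources: M. Waldschmidt, *Open Diophantine Problems*, Moscow Math. J. 4 (2004), §3.2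
Conjecture 3.17; J. Fresán (2024), Ex. 2.6 (Euler's `ζ(2k) ∈ ℚ π^{2k}`); M. Kontsevich,
D. Zagier, *Periods* (2001), §1.1. No definition is introduced and no statement of the tree is
changed or restated (the exponent vectors are packaged in the existential lemma
`exists_indepZeta_exponents`).
-/

noncomputable section

open MvPolynomial
open Literature.NumberTheory.Transcendental

namespace Summit.KontsevichZagierPeriods.HurwitzMicroSectors.NormalFormPrinciple.PiBox.LevelOne

/-- Evaluating the monomial `X^(single i k) = X_i ^ k` at `piOddZetaFamily` gives
`piOddZetaFamily i ^ k` (Mathlib `MvPolynomial.aeval_monomial`). [folklore] -/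
theorem aeval_piOddZetaFamily_monomial_single (i k : ℕ) :
    aeval piOddZetaFamily (monomial (Finsupp.single i k) (1 : ℚ)) = piOddZetaFamily i ^ k := by
  rw [aeval_monomial, map_one, one_mul, Finsupp.prod_single_index]
  exact pow_zero _

/-- **Exponent vectors of the zeta values (Euler, in monomial form).** There is an assignment
`e : ℕ → (ℕ →₀ ℕ)` of exponent vectors (in the variables of `MvPolynomial ℕ ℚ` evaluated at
`piOddZetaFamily`, `X₀ ↦ π`, `X_{m+1} ↦ ζ(2m+3)`) which on `{j | 2 ≤ j}` is non-zero and
injective and represents each `ζ(j)` up to a non-zero rational factor,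
`ζ(j) = q · (X^(e j))(π, ζ(3), ζ(5), …)`, `q ∈ ℚ`, `q ≠ 0`: namely `e j = X₀ʲ` for even `j = 2k`
(Euler's `ζ(2k) = q_k π^{2k}`, `q_k ≠ 0`, the tree's
`Literature.Barriers.KontsevichZagierPeriods.exists_rat_ne_zero_zetaValue_two_mul_eq`) and
`e j = X_{j/2}` for odd `j` (`ζ(2m+3) = piOddZetaFamily (m+1)`, factor `1`).
[cite: Fresan2024, Ex. 2.6] -/
theorem exists_indepZeta_exponents :
    ∃ e : ℕ → (ℕ →₀ ℕ),
      (∀ j, 2 ≤ j → e j ≠ 0) ∧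
      (∀ i j, 2 ≤ i → 2 ≤ j → e i = e j → i = j) ∧
      (∀ j, 2 ≤ j → ∃ q : ℚ, q ≠ 0 ∧
        zetaValue j = (q : ℝ) * aeval piOddZetaFamily (monomial (e j) (1 : ℚ))) := by
  refine ⟨fun j => if j % 2 = 0 then Finsupp.single 0 j else Finsupp.single (j / 2) 1,
    fun j hj => ?_, fun i j hi hj h => ?_, fun j hj => ?_⟩
  · -- non-zero
    dsimp only
    split_ifs with h
    · exact Finsupp.single_ne_zero.mpr (by omega)
    · exact Finsupp.single_ne_zero.mpr one_ne_zero
  · -- injective on `2 ≤ ·`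
    dsimp only at h
    split_ifs at h with h₁ h₂ h₂
    · exact Finsupp.single_injective 0 h
    · rcases (Finsupp.single_eq_single_iff _ _ _ _).1 h with ⟨-, h3⟩ | ⟨h3, -⟩ <;> omega
    · rcases (Finsupp.single_eq_single_iff _ _ _ _).1 h with ⟨-, h3⟩ | ⟨-, h3⟩ <;> omega
    · have h3 : i / 2 = j / 2 := (Finsupp.single_left_inj one_ne_zero).1 h
      omega
  · -- the rational factor
    dsimp only
    rcases Nat.even_or_odd' j with ⟨k, hk | hk⟩
    · -- even `j = 2k`, `k ≠ 0`: Euler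
      have hk0 : k ≠ 0 := by omega
      obtain ⟨q, hq0, hq⟩ :=
        Literature.Barriers.KontsevichZagierPeriods.exists_rat_ne_zero_zetaValue_two_mul_eq hk0
      refine ⟨q, hq0, ?_⟩
      rw [if_pos (show j % 2 = 0 by omega), aeval_piOddZetaFamily_monomial_single, hk, hq]
      rfl
    · -- odd `j = 2k + 1`, `k = m + 1`: a member of the family
      obtain ⟨m, rfl⟩ : ∃ m, k = m + 1 := ⟨k - 1, by omega⟩
      refine ⟨1, one_ne_zero, ?_⟩
      have hj2 : j / 2 = m + 1 := by omega
      rw [if_neg (show ¬ (j % 2 = 0) by omega), hj2, aeval_piOddZetaFamily_monomial_single,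
        pow_one, Rat.cast_one, one_mul, hk]
      show zetaValue (2 * (m + 1) + 1) = zetaValue (2 * m + 3)
      ring_nf

/-- **`Indep_ℚ(1, ζ(2), …, ζ(D))` from the algebraic independence of `π, ζ(3), ζ(5), …`.**
Under the open conjecture `PiOddZetaAlgebraicIndependent` ("The numbers
`π, ζ(3), ζ(5), …, ζ(2n+1), …` are algebraically independent over `ℚ`", taken as the explicit
hypothesis `h`), every rational linear relation `Σ_{2 ≤ j ≤ D} n_j ζ(j) + r = 0` among
`1, ζ(2), ζ(3), …, ζ(D)` is trivial: `r = 0` and all `n_j = 0`. (Even zeta values are non-zero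
rational multiples of powers of `π` by Euler, odd ones are members of the family, and distinct
`j` give distinct non-constant monomials, so the relation is the vanishing at an algebraically
independent point of a polynomial whose coefficients are `r` and the `n_j q_j`.) This is the
hypothesis `hind` of the level-one box tower rigidity.
[cite: Waldschmidt2004, §3.2 Conjecture 3.17] -/
theorem indepZeta_of_piOddZetaAlgebraicIndependent (h : PiOddZetaAlgebraicIndependent) (D : ℕ) :
    ∀ (n : ℕ → ℚ) (r : ℚ), (∑ j ∈ Finset.Icc 2 D, (n j : ℝ) * zetaValue j) + r = 0 →
      r = 0 ∧ ∀ j ∈ Finset.Icc 2 D, n j = 0 := by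
  classical
  intro n r hrel
  have h' : AlgebraicIndependent ℚ piOddZetaFamily := h
  obtain ⟨e, he0, heinj, heq⟩ := exists_indepZeta_exponents
  -- the rational factors `q j` (`ζ(j) = q j · X^(e j)` at the family), junk `1` below `j = 2`
  have hq : ∀ j : ℕ, ∃ q : ℚ, 2 ≤ j → q ≠ 0 ∧
      zetaValue j = (q : ℝ) * aeval piOddZetaFamily (monomial (e j) (1 : ℚ)) := by
    intro j
    by_cases hj : 2 ≤ j
    · obtain ⟨q, hq0, hq⟩ := heq j hj
      exact ⟨q, fun _ => ⟨hq0, hq⟩⟩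
    · exact ⟨1, fun hj' => absurd hj' hj⟩
  choose q hq using hq
  -- the polynomial relation
  set F : MvPolynomial ℕ ℚ :=
    C r + ∑ j ∈ Finset.Icc 2 D, C (n j * q j) * monomial (e j) (1 : ℚ) with hF
  have haeval : aeval piOddZetaFamily F = (∑ j ∈ Finset.Icc 2 D, (n j : ℝ) * zetaValue j) + r := by
    rw [hF, map_add, map_sum, aeval_C, eq_ratCast, add_comm]
    congr 1
    refine Finset.sum_congr rfl fun j hj => ?_
    have hj2 : 2 ≤ j := (Finset.mem_Icc.1 hj).1
    rw [map_mul, aeval_C, eq_ratCast, (hq j hj2).2, Rat.cast_mul, mul_assoc]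
  have hF0 : F = 0 := h'.eq_zero_of_aeval_eq_zero F (haeval.trans hrel)
  -- coefficients of `F`
  have hcoeff0 : coeff 0 F = r := by
    rw [hF, coeff_add, coeff_sum, coeff_zero_C, Finset.sum_eq_zero, add_zero]
    intro i hi
    rw [coeff_C_mul, coeff_monomial, if_neg (he0 i (Finset.mem_Icc.1 hi).1), mul_zero]
  have hcoeff : ∀ j ∈ Finset.Icc 2 D, coeff (e j) F = n j * q j := by
    intro j hj
    have hj2 : 2 ≤ j := (Finset.mem_Icc.1 hj).1
    rw [hF, coeff_add, coeff_sum, coeff_C, if_neg (fun h0 => he0 j hj2 h0.symm), zero_add,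
      Finset.sum_eq_single j]
    · rw [coeff_C_mul, coeff_monomial, if_pos rfl, mul_one]
    · intro i hi hij
      rw [coeff_C_mul, coeff_monomial,
        if_neg (fun h0 => hij (heinj i j (Finset.mem_Icc.1 hi).1 hj2 h0)), mul_zero]
    · intro hj'
      exact absurd hj hj'
  refine ⟨?_, fun j hj => ?_⟩
  · have h0 := hcoeff0
    rw [hF0, coeff_zero] at h0
    exact h0.symm
  · have h1 := hcoeff j hj
    rw [hF0, coeff_zero] at h1
    rcases mul_eq_zero.1 h1.symm with h2 | h2
    · exact h2
    · exact absurd h2 (hq j (Finset.mem_Icc.1 hj).1).1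

end Summit.KontsevichZagierPeriods.HurwitzMicroSectors.NormalFormPrinciple.PiBox.LevelOne

end
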